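import Mathlib
import HarnessLib
import Literature.MathematicalPhysics.KineticTheory.VelocityFlipNoise
import Summits.AtomisticToContinuum.FouriersLaw.Theorems.VanishingNoiseTransferNoisyFourierAbelPairingIdentity

/-!
# The level-`s` Thomson lower bound for the Abel pairing, and bulk Abel–GK positivity from an asymptotically
# half-conserved witness family (line `abel-storage-decay`, crux `VanishingNoiseTransfer.NoisyFourier`,
# stmt-AtomisticToContinuum-11977, stub B `stub_bulkAbelGKPositivity`)

`--supports stmt-AtomisticToContinuum-11977` file (worker B of lead c6), part 2 (part 1:
`…NoisyFourierAbelPairingIdentity`, the energy and pairing identities). Setting as there; `J = Σ_i j_i` the total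
current, `σ_L(s) = ∫ J u dμ_T` the Abel pairing of a classical corrector `u` at `s > 0` (`ε > 0`),
`E(f) = Σ_i ‖f∘F_i − f‖²`, `P₀` the average over the `2^L` momentum-sign patterns, `B = bathWeight L`.

* `abelThomson_linear`, `abelThomson_sq` — the LEVEL-`s` THOMSON LOWER BOUND: for every test function `w ∈ C²` with
  `w, Xw, L_{T,T}w ∈ L²(μ_T)` and every `t : ℝ`, `t⟨J,w⟩ ≤ σ_L(s) + (t²/2) Q_s(w)`, hence
  `⟨J,w⟩² ≤ 2 σ_L(s) Q_s(w)`, with the cost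
  `Q_s(w) = s‖w‖² + (ε/2)E(w) + γTΣ_i B_i‖∂_{p_i}w‖² + ‖Xw‖²/ε + ‖P₀Xw‖²/s`
  (pairing identity; `⟨u, Xw⟩ = ⟨u − P₀u, Xw⟩ + ⟨P₀u, P₀Xw⟩`; Cauchy–Schwarz and Young termwise; the landed sector
  gap `4‖u − P₀u‖² ≤ E(u)` (`stub_flipSectorGap`) absorbs the first piece into the flip dissipation, so the only
  `1/s`-singular cost is the PATTERN component `P₀Xw`; the `u`-side adds up to
  `s‖u‖² + (3ε/8)E(u) + (γT/2)Σ_i B_i‖∂_{p_i}u‖² ≤ σ_L(s)` by the energy identity).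
* `bulkPositivity_of_witnessFamily` — hence an ASYMPTOTICALLY HALF-CONSERVED WITNESS FAMILY (`c₁ > 0`, `c₂`; for
  every `δ > 0` and `L ≥ L₀(δ)` a test function with `⟨J,w⟩ ≥ c₁(L−1)`, costs `‖w‖², E(w), Σ_i B_i‖∂_{p_i}w‖²,
  ‖Xw‖² ≤ c₂(L−1)` and pattern defect `‖P₀Xw‖² ≤ δ(L−1)`) implies the registered stub B
  `stub_bulkAbelGKPositivity` verbatim: at `δ = s`, `σ_L(s)/(L−1) ≥ c₁²/(2c₃)` for `L ≥ L₀(s)` with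
  `c₃ = c₂⁺(1 + ε/2 + γT + 1/ε) + 1`, so every fixed-`s` per-bond limit is `≥ κ₀T²`, `κ₀ = c₁²/(2c₃T²)`, `s₁ = 1`.
* `helper_abelThomsonLowerBound`, `helper_bulkPositivityOfWitnessFamily` — registered notation-free restatements.

The exact (δ = 0) family is c2/c5's open `HalfConservedWitnessFamily`; the δ-relaxation is what the sector gap buys.
For flips alone such a family is open in print (Bernardin–Olla 2011 §6.2: lower bounds use the exchange noise).
References: Bernardin–Olla 2011 §5–6; Sethuraman–Varadhan–Yau 2000 (variational formulas); folklore.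
No definitions; axioms `propext`, `Classical.choice`, `Quot.sound` only.
-/

noncomputable section

open MeasureTheory Filter Topology
open scoped BigOperators
open Literature.MathematicalPhysics.KineticTheory.HeatConduction
open Summit.AtomisticToContinuum.FouriersLaw.Theorems.SuperadditiveResistance.DeviceLiouville (liouvilleOp bathOp)
open Summit.AtomisticToContinuum.FouriersLaw.Theorems.SuperadditiveResistance.Kubo (memLp_partialP)
open Summit.AtomisticToContinuum.FouriersLaw.Theorems.SuperadditiveResistance.KuboPlain
  (generator_eq_liouvilleOp_add_bathOp)
open Summit.AtomisticToContinuum.FouriersLaw.Theorems.VanishingNoiseBound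
  (memLp_comp_momentumFlip memLp_flipNoise flip_forwardPair gibbs_flipInvariant)
open Summit.AtomisticToContinuum.FouriersLaw.Cruxes.NoisyFourier.AbelKapitzaEvenCorrector (stub_flipSectorGap)
open Summit.AtomisticToContinuum.FouriersLaw.Cruxes.NoisyFourier.AbelKapitzaEvenCorrector.AbelTransfer
  (memLp_totalCurrent memLp_patternAverage)
open Summit.AtomisticToContinuum.FouriersLaw.Theorems.NoisyFourier.StorageDecay (integral_sq_eq_pattern_add)
open Summit.AtomisticToContinuum.FouriersLaw.Theorems.OddResponseBound.Negative.OddPairing (sq_integral_mul_le)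

namespace Summit.AtomisticToContinuum.FouriersLaw.Theorems.NoisyFourier.AbelThomson

section Chain

variable {ω₂ lam β γ : ℝ}

/-! ## The level-`s` Thomson lower bound -/

/-- **Level-`s` Thomson lower bound (linear form).** For a classical Abel corrector `u` at `s > 0` (`ε > 0`) and a
test function `w ∈ C²` with `w, Xw, L_{T,T}w ∈ L²(μ_T)`, for every `t : ℝ`:
`t ∫ w J dμ_T ≤ ∫ J u dμ_T + (t²/2)·(s‖w‖² + (ε/2)E(w) + γTΣ_i B_i‖∂_{p_i}w‖² + ‖Xw‖²/ε + ‖P₀Xw‖²/s)`.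
Proof: the pairing identity, the pattern split `⟨u,Xw⟩ = ⟨u − P₀u, Xw⟩ + ⟨P₀u, P₀Xw⟩`, Cauchy–Schwarz and Young
for each term, the sector gap `4‖u − P₀u‖² ≤ E(u)`, `‖P₀u‖ ≤ ‖u‖`, and the energy identity (the `u`-side adds
up to `s‖u‖² + (3ε/8)E(u) + (γT/2)Σ_i B_i‖∂_{p_i}u‖² ≤ σ`). [folklore] -/
theorem abelThomson_linear (hω : 0 < ω₂) (hl : 0 < lam) (hβ : 0 < β) (hγ : 0 < γ) {T : ℝ} (hT : 0 < T)
    {ε : ℝ} (hε : 0 < ε) {L : ℕ} {s : ℝ} (hs : 0 < s) {u w : PhaseSpace L → ℝ}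
    (huC : ContDiff ℝ 2 u) (hu2 : MemLp u 2 ((pinnedChain ω₂ lam β γ).gibbsMeasure L T))
    (hpde : ∀ x, (pinnedChain ω₂ lam β γ).flipGenerator L T T ε u x =
      s * u x - ∑ i, (pinnedChain ω₂ lam β γ).bondCurrent L i x)
    (hwC : ContDiff ℝ 2 w) (hw2 : MemLp w 2 ((pinnedChain ω₂ lam β γ).gibbsMeasure L T))
    (hXw2 : MemLp ((pinnedChain ω₂ lam β γ).liouvillian L w) 2 ((pinnedChain ω₂ lam β γ).gibbsMeasure L T))
    (hGw2 : MemLp ((pinnedChain ω₂ lam β γ).generator L T T w) 2 ((pinnedChain ω₂ lam β γ).gibbsMeasure L T))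
    (t : ℝ) :
    t * ∫ x, w x * (∑ i, (pinnedChain ω₂ lam β γ).bondCurrent L i x) ∂((pinnedChain ω₂ lam β γ).gibbsMeasure L T) ≤
      (∫ x, (∑ i, (pinnedChain ω₂ lam β γ).bondCurrent L i x) * u x ∂((pinnedChain ω₂ lam β γ).gibbsMeasure L T)) +
        t ^ 2 / 2 * (s * ∫ x, w x ^ 2 ∂((pinnedChain ω₂ lam β γ).gibbsMeasure L T) +
          ε / 2 * ∑ i, ∫ x, (w (momentumFlip i x) - w x) ^ 2 ∂((pinnedChain ω₂ lam β γ).gibbsMeasure L T) +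
          γ * T * ∑ i, OscillatorChain.bathWeight L i *
            ∫ x, partialP i w x ^ 2 ∂((pinnedChain ω₂ lam β γ).gibbsMeasure L T) +
          1 / ε * ∫ x, (pinnedChain ω₂ lam β γ).liouvillian L w x ^ 2 ∂((pinnedChain ω₂ lam β γ).gibbsMeasure L T) +
          1 / s * ∫ x, ((∑ σ : Fin L → Bool, (pinnedChain ω₂ lam β γ).liouvillian L w
            (x.1, fun i => if σ i then -x.2 i else x.2 i)) / 2 ^ L) ^ 2
              ∂((pinnedChain ω₂ lam β γ).gibbsMeasure L T)) := by
  -- the identities (stated before abbreviating, so that `set` rewrites them)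
  have hJ2 := memLp_totalCurrent hω hl.le hβ.le γ L hT (T := T)
  have hE := corrector_energy_eq hω hl hβ hγ hT ε hJ2 huC hu2 hpde
  have hI := pairing_identity hω hl hβ hγ hT ε hJ2 huC hu2 hpde hwC hw2 hXw2 hGw2
  have hflip := gibbs_flipInvariant (ω₂ := ω₂) (lam := lam) (β := β) (γ := γ) L T
  have hGap := stub_flipSectorGap L ((pinnedChain ω₂ lam β γ).gibbsMeasure L T) hflip u hu2
  have hPyth := integral_sq_eq_pattern_add ((pinnedChain ω₂ lam β γ).gibbsMeasure L T) hflip hu2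
  have hSplit := integral_mul_pattern_split hflip hu2 hXw2
  set P := pinnedChain ω₂ lam β γ with hP
  set μ := P.gibbsMeasure L T with hμ
  set B := OscillatorChain.bathWeight L with hB
  set g : PhaseSpace L → ℝ := P.liouvillian L w with hg
  set pu : PhaseSpace L → ℝ := fun x =>
    (∑ σ : Fin L → Bool, u (x.1, fun i => if σ i then -x.2 i else x.2 i)) / 2 ^ L with hpu
  set pg : PhaseSpace L → ℝ := fun x =>
    (∑ σ : Fin L → Bool, g (x.1, fun i => if σ i then -x.2 i else x.2 i)) / 2 ^ L with hpg
  have hB0 : ∀ i, 0 ≤ B i := Literature.MathematicalPhysics.KineticTheory.HeatConduction.bathWeight_nonneg L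
  -- square integrability of the players
  have hSu2 : MemLp (flipNoise L u) 2 μ := memLp_flipNoise hflip hu2
  set kf : PhaseSpace L → ℝ := fun x => ((∑ i, P.bondCurrent L i x) - s * u x) + ε * flipNoise L u x with hkf
  have hkf2 : MemLp kf 2 μ := (hJ2.sub (hu2.const_mul s)).add (hSu2.const_mul ε)
  have hpu' : ∀ x, 1 * liouvilleOp P L u x + γ * bathOp L B T u x = -kf x := fun x =>
    flip_forwardPair (ω₂ := ω₂) (lam := lam) (β := β) (γ := γ) L T ε
      (k := fun y => (∑ i, P.bondCurrent L i y) - s * u y)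
      (fun y => by
        show P.flipGenerator L T T ε u y = -((∑ i, P.bondCurrent L i y) - s * u y)
        rw [hpde y]
        ring) x
  set kw : PhaseSpace L → ℝ := fun x => -P.generator L T T w x with hkw
  have hkw2 : MemLp kw 2 μ := hGw2.neg
  have hpw : ∀ x, 1 * liouvilleOp P L w x + γ * bathOp L B T w x = -kw x := by
    intro x
    simp only [hkw, neg_neg]
    rw [generator_eq_liouvilleOp_add_bathOp]
    show 1 * liouvilleOp P L w x + γ * bathOp L B T w x = liouvilleOp P L w x + γ * bathOp L B T w x
    ring
  have hdu2 : ∀ i, 0 < B i → MemLp (partialP i u) 2 μ := fun i hi =>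
    memLp_partialP hω hl.le hβ.le γ L hT B hB0 1 hγ huC hu2 hkf2 hpu' hi
  have hdw2 : ∀ i, 0 < B i → MemLp (partialP i w) 2 μ := fun i hi =>
    memLp_partialP hω hl.le hβ.le γ L hT B hB0 1 hγ hwC hw2 hkw2 hpw hi
  have hui : ∀ i, MemLp (fun x => u (momentumFlip i x) - u x) 2 μ := fun i =>
    (memLp_comp_momentumFlip hflip hu2 i).sub hu2
  have hwi : ∀ i, MemLp (fun x => w (momentumFlip i x) - w x) 2 μ := fun i =>
    (memLp_comp_momentumFlip hflip hw2 i).sub hw2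
  have hg2 : MemLp g 2 μ := hXw2
  have hpu2 : MemLp pu 2 μ := memLp_patternAverage hflip hu2
  have hpg2 : MemLp pg 2 μ := memLp_patternAverage hflip hg2
  have hupu2 : MemLp (fun x => u x - pu x) 2 μ := hu2.sub hpu2
  -- nonnegativity
  have hEu0 : 0 ≤ ∑ i, ∫ x, (u (momentumFlip i x) - u x) ^ 2 ∂μ :=
    Finset.sum_nonneg fun i _ => integral_nonneg fun x => sq_nonneg _
  have hDu0 : 0 ≤ ∑ i, B i * ∫ x, partialP i u x ^ 2 ∂μ :=
    Finset.sum_nonneg fun i _ => mul_nonneg (hB0 i) (integral_nonneg fun x => sq_nonneg _)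
  have hUpu0 : 0 ≤ ∫ x, (u x - pu x) ^ 2 ∂μ := integral_nonneg fun x => sq_nonneg _
  -- term 1: `t·s⟨u,w⟩`
  have h1 : t * ∫ x, u x * w x ∂μ ≤ (1 * ∫ x, u x ^ 2 ∂μ + 1⁻¹ * (t ^ 2 * ∫ x, w x ^ 2 ∂μ)) / 2 :=
    mul_le_of_sq_le_mul t (sq_integral_mul_le hu2 hw2) (integral_nonneg fun x => sq_nonneg _)
      (integral_nonneg fun x => sq_nonneg _) one_pos
  have h1s := mul_le_mul_of_nonneg_left h1 hs.le
  -- term 2: the polarised flip Dirichlet form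
  have h2 : t * ∑ i, ∫ x, (u (momentumFlip i x) - u x) * (w (momentumFlip i x) - w x) ∂μ ≤
      ((∑ i, ∫ x, (u (momentumFlip i x) - u x) ^ 2 ∂μ) +
        t ^ 2 * ∑ i, ∫ x, (w (momentumFlip i x) - w x) ^ 2 ∂μ) / 2 := by
    have h2i : ∀ i, t * ∫ x, (u (momentumFlip i x) - u x) * (w (momentumFlip i x) - w x) ∂μ ≤
        (1 * ∫ x, (u (momentumFlip i x) - u x) ^ 2 ∂μ +
          1⁻¹ * (t ^ 2 * ∫ x, (w (momentumFlip i x) - w x) ^ 2 ∂μ)) / 2 := fun i =>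
      mul_le_of_sq_le_mul t (sq_integral_mul_le (hui i) (hwi i)) (integral_nonneg fun x => sq_nonneg _)
        (integral_nonneg fun x => sq_nonneg _) one_pos
    calc t * ∑ i, ∫ x, (u (momentumFlip i x) - u x) * (w (momentumFlip i x) - w x) ∂μ
        = ∑ i, t * ∫ x, (u (momentumFlip i x) - u x) * (w (momentumFlip i x) - w x) ∂μ := Finset.mul_sum _ _ _
      _ ≤ ∑ i, (1 * ∫ x, (u (momentumFlip i x) - u x) ^ 2 ∂μ +
          1⁻¹ * (t ^ 2 * ∫ x, (w (momentumFlip i x) - w x) ^ 2 ∂μ)) / 2 := Finset.sum_le_sum fun i _ => h2i i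
      _ = ((∑ i, ∫ x, (u (momentumFlip i x) - u x) ^ 2 ∂μ) +
          t ^ 2 * ∑ i, ∫ x, (w (momentumFlip i x) - w x) ^ 2 ∂μ) / 2 := by
          rw [Finset.mul_sum, ← Finset.sum_add_distrib, Finset.sum_div]
          exact Finset.sum_congr rfl fun i _ => by ring
  have h2e := mul_le_mul_of_nonneg_left h2 (by positivity : (0 : ℝ) ≤ ε / 2)
  -- term 4: the bath Dirichlet form
  have h4 : t * ∑ i, B i * ∫ x, partialP i u x * partialP i w x ∂μ ≤
      ((∑ i, B i * ∫ x, partialP i u x ^ 2 ∂μ) + t ^ 2 * ∑ i, B i * ∫ x, partialP i w x ^ 2 ∂μ) / 2 := by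
    have h4i : ∀ i, t * (B i * ∫ x, partialP i u x * partialP i w x ∂μ) ≤
        B i * ((1 * ∫ x, partialP i u x ^ 2 ∂μ + 1⁻¹ * (t ^ 2 * ∫ x, partialP i w x ^ 2 ∂μ)) / 2) := by
      intro i
      rcases (hB0 i).eq_or_lt with h0 | hpos
      · rw [← h0]
        simp
      · have h := mul_le_of_sq_le_mul t (sq_integral_mul_le (hdu2 i hpos) (hdw2 i hpos))
          (integral_nonneg fun x => sq_nonneg _) (integral_nonneg fun x => sq_nonneg _) one_pos
        calc t * (B i * ∫ x, partialP i u x * partialP i w x ∂μ)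
            = B i * (t * ∫ x, partialP i u x * partialP i w x ∂μ) := by ring
          _ ≤ _ := mul_le_mul_of_nonneg_left h hpos.le
    calc t * ∑ i, B i * ∫ x, partialP i u x * partialP i w x ∂μ
        = ∑ i, t * (B i * ∫ x, partialP i u x * partialP i w x ∂μ) := Finset.mul_sum _ _ _
      _ ≤ ∑ i, B i * ((1 * ∫ x, partialP i u x ^ 2 ∂μ + 1⁻¹ * (t ^ 2 * ∫ x, partialP i w x ^ 2 ∂μ)) / 2) :=
          Finset.sum_le_sum fun i _ => h4i i
      _ = ((∑ i, B i * ∫ x, partialP i u x ^ 2 ∂μ) + t ^ 2 * ∑ i, B i * ∫ x, partialP i w x ^ 2 ∂μ) / 2 := by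
          rw [Finset.mul_sum, ← Finset.sum_add_distrib, Finset.sum_div]
          exact Finset.sum_congr rfl fun i _ => by ring
  have h4g := mul_le_mul_of_nonneg_left h4 (by positivity : (0 : ℝ) ≤ γ * T)
  -- term 3: `⟨u, Xw⟩ = ⟨u − P₀u, Xw⟩ + ⟨P₀u, P₀Xw⟩`
  have h3a : t * ∫ x, (u x - pu x) * g x ∂μ ≤
      (ε * ∫ x, (u x - pu x) ^ 2 ∂μ + ε⁻¹ * (t ^ 2 * ∫ x, g x ^ 2 ∂μ)) / 2 :=
    mul_le_of_sq_le_mul t (sq_integral_mul_le hupu2 hg2) hUpu0 (integral_nonneg fun x => sq_nonneg _) hε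
  have h3b : t * ∫ x, pu x * pg x ∂μ ≤ (s * ∫ x, pu x ^ 2 ∂μ + s⁻¹ * (t ^ 2 * ∫ x, pg x ^ 2 ∂μ)) / 2 :=
    mul_le_of_sq_le_mul t (sq_integral_mul_le hpu2 hpg2) (integral_nonneg fun x => sq_nonneg _)
      (integral_nonneg fun x => sq_nonneg _) hs
  have hgapε := mul_le_mul_of_nonneg_left hGap hε.le
  have hps : s * ∫ x, pu x ^ 2 ∂μ ≤ s * ∫ x, u x ^ 2 ∂μ := mul_le_mul_of_nonneg_left (by linarith) hs.le
  -- assemble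
  have hcomm : ∫ x, (∑ i, P.bondCurrent L i x) * u x ∂μ = ∫ x, u x * (∑ i, P.bondCurrent L i x) ∂μ :=
    integral_congr_ae (ae_of_all _ fun x => by ring)
  have hIt : t * ∫ x, w x * (∑ i, P.bondCurrent L i x) ∂μ =
      t * (s * ∫ x, u x * w x ∂μ +
        ε / 2 * ∑ i, ∫ x, (u (momentumFlip i x) - u x) * (w (momentumFlip i x) - w x) ∂μ +
        ∫ x, u x * g x ∂μ + γ * T * ∑ i, B i * ∫ x, partialP i u x * partialP i w x ∂μ) := by
    rw [hI]
  rw [hcomm, hIt, hSplit, one_div, one_div]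
  simp only [inv_one, one_mul] at h1s h2e h4g
  nlinarith [h1s, h2e, h4g, h3a, h3b, hgapε, hps, hE, hEu0, hDu0, hUpu0, hε.le, hs.le,
    mul_pos hγ hT, sq_nonneg t]

/-- **Level-`s` Thomson lower bound (quadratic form).** In the setting of `abelThomson_linear`:
`(∫ w J dμ_T)² ≤ 2 (∫ J u dμ_T) · Q_s(w)` with the cost
`Q_s(w) = s‖w‖² + (ε/2)E(w) + γTΣ_i B_i‖∂_{p_i}w‖² + ‖Xw‖²/ε + ‖P₀Xw‖²/s` (optimise `t`; non-positive
discriminant). So `σ_L(s) ≥ ⟨J,w⟩²/(2Q_s(w))` for every admissible `w` — the dual variational principle for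
`(s − L_ε)` restricted to classical test functions. [folklore] -/
theorem abelThomson_sq (hω : 0 < ω₂) (hl : 0 < lam) (hβ : 0 < β) (hγ : 0 < γ) {T : ℝ} (hT : 0 < T)
    {ε : ℝ} (hε : 0 < ε) {L : ℕ} {s : ℝ} (hs : 0 < s) {u w : PhaseSpace L → ℝ}
    (huC : ContDiff ℝ 2 u) (hu2 : MemLp u 2 ((pinnedChain ω₂ lam β γ).gibbsMeasure L T))
    (hpde : ∀ x, (pinnedChain ω₂ lam β γ).flipGenerator L T T ε u x =
      s * u x - ∑ i, (pinnedChain ω₂ lam β γ).bondCurrent L i x)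
    (hwC : ContDiff ℝ 2 w) (hw2 : MemLp w 2 ((pinnedChain ω₂ lam β γ).gibbsMeasure L T))
    (hXw2 : MemLp ((pinnedChain ω₂ lam β γ).liouvillian L w) 2 ((pinnedChain ω₂ lam β γ).gibbsMeasure L T))
    (hGw2 : MemLp ((pinnedChain ω₂ lam β γ).generator L T T w) 2 ((pinnedChain ω₂ lam β γ).gibbsMeasure L T)) :
    (∫ x, w x * (∑ i, (pinnedChain ω₂ lam β γ).bondCurrent L i x) ∂((pinnedChain ω₂ lam β γ).gibbsMeasure L T)) ^ 2 ≤
      2 * (∫ x, (∑ i, (pinnedChain ω₂ lam β γ).bondCurrent L i x) * u x ∂((pinnedChain ω₂ lam β γ).gibbsMeasure L T)) *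
        (s * ∫ x, w x ^ 2 ∂((pinnedChain ω₂ lam β γ).gibbsMeasure L T) +
          ε / 2 * ∑ i, ∫ x, (w (momentumFlip i x) - w x) ^ 2 ∂((pinnedChain ω₂ lam β γ).gibbsMeasure L T) +
          γ * T * ∑ i, OscillatorChain.bathWeight L i *
            ∫ x, partialP i w x ^ 2 ∂((pinnedChain ω₂ lam β γ).gibbsMeasure L T) +
          1 / ε * ∫ x, (pinnedChain ω₂ lam β γ).liouvillian L w x ^ 2 ∂((pinnedChain ω₂ lam β γ).gibbsMeasure L T) +
          1 / s * ∫ x, ((∑ σ : Fin L → Bool, (pinnedChain ω₂ lam β γ).liouvillian L w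
            (x.1, fun i => if σ i then -x.2 i else x.2 i)) / 2 ^ L) ^ 2
              ∂((pinnedChain ω₂ lam β γ).gibbsMeasure L T)) := by
  have h := abelThomson_linear hω hl hβ hγ hT hε hs huC hu2 hpde hwC hw2 hXw2 hGw2
  set A := ∫ x, w x * (∑ i, (pinnedChain ω₂ lam β γ).bondCurrent L i x) ∂((pinnedChain ω₂ lam β γ).gibbsMeasure L T)
  set σ := ∫ x, (∑ i, (pinnedChain ω₂ lam β γ).bondCurrent L i x) * u x ∂((pinnedChain ω₂ lam β γ).gibbsMeasure L T)
  set Q := s * ∫ x, w x ^ 2 ∂((pinnedChain ω₂ lam β γ).gibbsMeasure L T) +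
          ε / 2 * ∑ i, ∫ x, (w (momentumFlip i x) - w x) ^ 2 ∂((pinnedChain ω₂ lam β γ).gibbsMeasure L T) +
          γ * T * ∑ i, OscillatorChain.bathWeight L i *
            ∫ x, partialP i w x ^ 2 ∂((pinnedChain ω₂ lam β γ).gibbsMeasure L T) +
          1 / ε * ∫ x, (pinnedChain ω₂ lam β γ).liouvillian L w x ^ 2 ∂((pinnedChain ω₂ lam β γ).gibbsMeasure L T) +
          1 / s * ∫ x, ((∑ σ : Fin L → Bool, (pinnedChain ω₂ lam β γ).liouvillian L w
            (x.1, fun i => if σ i then -x.2 i else x.2 i)) / 2 ^ L) ^ 2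
              ∂((pinnedChain ω₂ lam β γ).gibbsMeasure L T)
  have hquad : ∀ t : ℝ, 0 ≤ Q / 2 * (t * t) + (-A) * t + σ := fun t => by nlinarith [h t]
  have hd := discrim_le_zero hquad
  rw [discrim] at hd
  nlinarith [hd]


/-! ## Bulk Abel–GK positivity from an asymptotically half-conserved witness family -/

/-- The arithmetic of the reduction: pairing `A ≥ c₁N`, costs `≤ c₂'N` (`c₂' ≥ 0`), pattern defect `≤ sN`,
and the Thomson bound `A² ≤ 2σQ_s` give `σ/N ≥ c₁²/(2c₃)` with `c₃ = c₂'(1 + ε/2 + γT + 1/ε) + 1` (`s ≤ 1`).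
[folklore] -/
theorem floor_arith {c₁ c₂' c₃ s ε γ T N A σ W1 Ew Dw W3 W5 : ℝ} (hs : 0 < s) (hs1 : s ≤ 1) (hε : 0 < ε)
    (hγT : 0 ≤ γ * T) (hN : 0 < N) (hc₁ : 0 < c₁) (hc₂ : 0 ≤ c₂')
    (hc₃ : c₃ = c₂' * (1 + ε / 2 + γ * T + 1 / ε) + 1) (hW10 : 0 ≤ W1) (hEw0 : 0 ≤ Ew) (hDw0 : 0 ≤ Dw)
    (hW30 : 0 ≤ W3) (hW50 : 0 ≤ W5) (hW1 : W1 ≤ c₂' * N) (hEw : Ew ≤ c₂' * N) (hDw : Dw ≤ c₂' * N)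
    (hW3 : W3 ≤ c₂' * N) (hW5 : W5 ≤ s * N) (hA : c₁ * N ≤ A)
    (hTh : A ^ 2 ≤ 2 * σ * (s * W1 + ε / 2 * Ew + γ * T * Dw + 1 / ε * W3 + 1 / s * W5)) :
    c₁ ^ 2 / (2 * c₃) ≤ σ / N := by
  have hc₃0 : 0 < c₃ := by
    rw [hc₃]
    positivity
  have hcN : 0 ≤ c₂' * N := mul_nonneg hc₂ hN.le
  -- the cost is `≤ c₃ N`
  have q1 : s * W1 ≤ c₂' * N := (mul_le_mul_of_nonneg_left hW1 hs.le).trans (mul_le_of_le_one_left hcN hs1)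
  have q2 : ε / 2 * Ew ≤ ε / 2 * (c₂' * N) := mul_le_mul_of_nonneg_left hEw (by positivity)
  have q3 : γ * T * Dw ≤ γ * T * (c₂' * N) := mul_le_mul_of_nonneg_left hDw hγT
  have q4 : 1 / ε * W3 ≤ 1 / ε * (c₂' * N) := mul_le_mul_of_nonneg_left hW3 (by positivity)
  have q5 : 1 / s * W5 ≤ N := by
    calc 1 / s * W5 ≤ 1 / s * (s * N) := mul_le_mul_of_nonneg_left hW5 (by positivity)
      _ = N := by field_simp
  have hQle : s * W1 + ε / 2 * Ew + γ * T * Dw + 1 / ε * W3 + 1 / s * W5 ≤ c₃ * N := by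
    have e : c₃ * N = c₂' * N + ε / 2 * (c₂' * N) + γ * T * (c₂' * N) + 1 / ε * (c₂' * N) + N := by
      rw [hc₃]
      ring
    rw [e]
    linarith
  have hQ0 : 0 ≤ s * W1 + ε / 2 * Ew + γ * T * Dw + 1 / ε * W3 + 1 / s * W5 := by
    have : 0 ≤ γ * T * Dw := mul_nonneg hγT hDw0
    positivity
  -- `A ≥ c₁ N > 0`, hence `σ > 0`
  have hA0 : 0 < c₁ * N := mul_pos hc₁ hN
  have hsq : (c₁ * N) ^ 2 ≤ 2 * σ * (s * W1 + ε / 2 * Ew + γ * T * Dw + 1 / ε * W3 + 1 / s * W5) :=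
    (pow_le_pow_left₀ hA0.le hA 2).trans hTh
  have hprod : 0 < 2 * σ * (s * W1 + ε / 2 * Ew + γ * T * Dw + 1 / ε * W3 + 1 / s * W5) :=
    lt_of_lt_of_le (by positivity) hsq
  rcases pos_and_pos_or_neg_and_neg_of_mul_pos hprod with ⟨h2σ, -⟩ | ⟨-, hQneg⟩
  · have hsq' : (c₁ * N) ^ 2 ≤ 2 * σ * (c₃ * N) := hsq.trans (mul_le_mul_of_nonneg_left hQle h2σ.le)
    rw [div_le_div_iff₀ (by positivity) hN]
    nlinarith [hsq', hN, hc₃0]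
  · exact absurd hQ0 (not_le.2 hQneg)

/-- **An asymptotically half-conserved witness family forces bulk Abel–GK positivity (stub B).** Hypothesis
`hW`: there are `c₁ > 0`, `c₂` such that for every `δ > 0` and all large `L` there is a test function
`w ∈ C²` with `w, Xw, L_{T,T}w ∈ L²(μ_T)`, pairing `∫ w J ≥ c₁(L−1)`, costs `‖w‖², E(w), Σ_i B_i‖∂_{p_i}w‖², ‖Xw‖²`
all `≤ c₂(L−1)` and pattern defect `‖P₀Xw‖² ≤ δ(L−1)`. Conclusion (the registered stub B of line
`abel-storage-decay` verbatim): with `c₃ = c₂⁺(1 + ε/2 + γT + 1/ε) + 1`, `κ₀ = c₁²/(2c₃T²)` and `s₁ = 1`, every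
fixed-`s` per-bond limit `K` of the Abel pairing along classical correctors at `s ∈ (0,1]` satisfies `K ≥ κ₀T²`:
`abelThomson_sq` with the witness at `δ = s` gives `c₁²(L−1)² ≤ 2σ_L(s)·c₃(L−1)` for `L ≥ L₀(s)` (`floor_arith`).
[folklore] -/
theorem bulkPositivity_of_witnessFamily
    (hW : ∀ (ω₂ lam β γ T ε : ℝ), 0 < ω₂ → 0 < lam → 0 < β → 0 < γ → 0 < T → 0 < ε →
      ∃ c₁ c₂ : ℝ, 0 < c₁ ∧ ∀ δ : ℝ, 0 < δ → ∃ L₀ : ℕ, ∀ (L : ℕ), L₀ ≤ L → 2 ≤ L →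
        ∃ w : PhaseSpace L → ℝ, ContDiff ℝ 2 w ∧ MemLp w 2 ((pinnedChain ω₂ lam β γ).gibbsMeasure L T) ∧
          MemLp ((pinnedChain ω₂ lam β γ).liouvillian L w) 2 ((pinnedChain ω₂ lam β γ).gibbsMeasure L T) ∧
          MemLp ((pinnedChain ω₂ lam β γ).generator L T T w) 2 ((pinnedChain ω₂ lam β γ).gibbsMeasure L T) ∧
          c₁ * ((L : ℝ) - 1) ≤ ∫ x, w x * ∑ i : Fin L, (pinnedChain ω₂ lam β γ).bondCurrent L i x
            ∂((pinnedChain ω₂ lam β γ).gibbsMeasure L T) ∧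
          ∫ x, w x ^ 2 ∂((pinnedChain ω₂ lam β γ).gibbsMeasure L T) ≤ c₂ * ((L : ℝ) - 1) ∧
          ∑ i : Fin L, ∫ x, (w (momentumFlip i x) - w x) ^ 2 ∂((pinnedChain ω₂ lam β γ).gibbsMeasure L T) ≤
            c₂ * ((L : ℝ) - 1) ∧
          ∑ i : Fin L, OscillatorChain.bathWeight L i *
            ∫ x, (partialP i w x) ^ 2 ∂((pinnedChain ω₂ lam β γ).gibbsMeasure L T) ≤ c₂ * ((L : ℝ) - 1) ∧
          ∫ x, ((pinnedChain ω₂ lam β γ).liouvillian L w x) ^ 2 ∂((pinnedChain ω₂ lam β γ).gibbsMeasure L T) ≤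
            c₂ * ((L : ℝ) - 1) ∧
          ∫ x, ((∑ σ : Fin L → Bool, (pinnedChain ω₂ lam β γ).liouvillian L w
            (x.1, fun i => if σ i then -x.2 i else x.2 i)) / 2 ^ L) ^ 2
              ∂((pinnedChain ω₂ lam β γ).gibbsMeasure L T) ≤ δ * ((L : ℝ) - 1)) :
    ∀ (ω₂ lam β γ T ε : ℝ), 0 < ω₂ → 0 < lam → 0 < β → 0 < γ → 0 < T → 0 < ε →
      ∃ κ₀ : ℝ, 0 < κ₀ ∧ ∃ s₁ : ℝ, 0 < s₁ ∧ s₁ ≤ 1 ∧ ∀ s : ℝ, 0 < s → s ≤ s₁ →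
        ∀ u : (L : ℕ) → PhaseSpace L → ℝ,
          (∀ L : ℕ, 2 ≤ L → ContDiff ℝ 2 (u L) ∧ MemLp (u L) 2 ((pinnedChain ω₂ lam β γ).gibbsMeasure L T) ∧
            ∀ x, (pinnedChain ω₂ lam β γ).flipGenerator L T T ε (u L) x =
              s * u L x - ∑ i : Fin L, (pinnedChain ω₂ lam β γ).bondCurrent L i x) →
          ∀ K : ℝ, Tendsto (fun L : ℕ => (∫ x, (∑ i : Fin L, (pinnedChain ω₂ lam β γ).bondCurrent L i x) * u L x
            ∂((pinnedChain ω₂ lam β γ).gibbsMeasure L T)) / ((L : ℝ) - 1)) atTop (𝓝 K) → κ₀ * T ^ 2 ≤ K := by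
  intro ω₂ lam β γ T ε hω hl hβ hγ hT hε
  obtain ⟨c₁, c₂, hc₁, hfam⟩ := hW ω₂ lam β γ T ε hω hl hβ hγ hT hε
  have hc₂ : c₂ ≤ max c₂ 0 := le_max_left _ _
  have hc₂0 : 0 ≤ max c₂ 0 := le_max_right _ _
  have hc₃ : 0 < max c₂ 0 * (1 + ε / 2 + γ * T + 1 / ε) + 1 := by positivity
  have hT2 : 0 < T ^ 2 := by positivity
  refine ⟨c₁ ^ 2 / (2 * (max c₂ 0 * (1 + ε / 2 + γ * T + 1 / ε) + 1) * T ^ 2), by positivity, 1, one_pos, le_rfl,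
    fun s hs hs1 u hu K hK => ?_⟩
  obtain ⟨L₀, hL₀⟩ := hfam s hs
  have hev : ∀ᶠ L : ℕ in atTop, c₁ ^ 2 / (2 * (max c₂ 0 * (1 + ε / 2 + γ * T + 1 / ε) + 1)) ≤
      (∫ x, (∑ i : Fin L, (pinnedChain ω₂ lam β γ).bondCurrent L i x) * u L x
        ∂((pinnedChain ω₂ lam β γ).gibbsMeasure L T)) / ((L : ℝ) - 1) := by
    filter_upwards [eventually_ge_atTop L₀, eventually_ge_atTop 2] with L hLL₀ hL2
    obtain ⟨w, hwC, hw2, hXw2, hGw2, hJw, hW1, hEw, hDw, hW3, hW5⟩ := hL₀ L hLL₀ hL2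
    obtain ⟨huC, hu2, hupde⟩ := hu L hL2
    have hTh := abelThomson_sq hω hl hβ hγ hT hε hs huC hu2 hupde hwC hw2 hXw2 hGw2
    have hN1 : 0 < (L : ℝ) - 1 := by
      have : (2 : ℝ) ≤ L := by exact_mod_cast hL2
      linarith
    have hmono : c₂ * ((L : ℝ) - 1) ≤ max c₂ 0 * ((L : ℝ) - 1) := mul_le_mul_of_nonneg_right hc₂ hN1.le
    exact floor_arith hs hs1 hε (mul_pos hγ hT).le hN1 hc₁ hc₂0 rfl (integral_nonneg fun x => sq_nonneg _)
      (Finset.sum_nonneg fun i _ => integral_nonneg fun x => sq_nonneg _)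
      (Finset.sum_nonneg fun i _ =>
        mul_nonneg (Literature.MathematicalPhysics.KineticTheory.HeatConduction.bathWeight_nonneg L i)
          (integral_nonneg fun x => sq_nonneg _))
      (integral_nonneg fun x => sq_nonneg _) (integral_nonneg fun x => sq_nonneg _) (hW1.trans hmono)
      (hEw.trans hmono) (hDw.trans hmono) (hW3.trans hmono) hW5 hJw hTh
  have hK' := ge_of_tendsto hK hev
  have e : c₁ ^ 2 / (2 * (max c₂ 0 * (1 + ε / 2 + γ * T + 1 / ε) + 1) * T ^ 2) * T ^ 2 =
      c₁ ^ 2 / (2 * (max c₂ 0 * (1 + ε / 2 + γ * T + 1 / ε) + 1)) := by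
    field_simp
  rw [e]
  exact hK'

end Chain

/-! ## Registered helpers (notation-free restatements) -/

/-- Registered helper sub-goal `helper_abelThomsonLowerBound` of crux stmt-AtomisticToContinuum-11977 (line
`abel-storage-decay`, stub B `stub_bulkAbelGKPositivity`): the level-`s` Thomson lower bound `abelThomson_sq`,
restated. [folklore] -/
theorem helper_abelThomsonLowerBound : ∀ (ω₂ lam β γ T ε : ℝ), 0 < ω₂ → 0 < lam → 0 < β → 0 < γ → 0 < T → 0 < ε → ∀ (L : ℕ) (s : ℝ), 0 < s → ∀ (u w : Literature.MathematicalPhysics.KineticTheory.HeatConduction.PhaseSpace L → ℝ), (ContDiff ℝ 2 u ∧ MeasureTheory.MemLp u 2 ((Literature.MathematicalPhysics.KineticTheory.HeatConduction.pinnedChain ω₂ lam β γ).gibbsMeasure L T) ∧ ∀ x, (Literature.MathematicalPhysics.KineticTheory.HeatConduction.pinnedChain ω₂ lam β γ).flipGenerator L T T ε u x = s * u x - ∑ i : Fin L, (Literature.MathematicalPhysics.KineticTheory.HeatConduction.pinnedChain ω₂ lam β γ).bondCurrent L i x) → ContDiff ℝ 2 w → MeasureTheory.MemLp w 2 ((Literature.MathematicalPhysics.KineticTheory.HeatConduction.pinnedChain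 ω₂ lam β γ).gibbsMeasure L T) → MeasureTheory.MemLp ((Literature.MathematicalPhysics.KineticTheory.HeatConduction.pinnedChain ω₂ lam β γ).liouvillian L w) 2 ((Literature.MathematicalPhysics.KineticTheory.HeatConduction.pinnedChain ω₂ lam β γ).gibbsMeasure L T) → MeasureTheory.MemLp ((Literature.MathematicalPhysics.KineticTheory.HeatConduction.pinnedChain ω₂ lam β γ).generator L T T w) 2 ((Literature.MathematicalPhysics.KineticTheory.HeatConduction.pinnedChain ω₂ lam β γ).gibbsMeasure L T) → (MeasureTheory.integral ((Literature.MathematicalPhysics.KineticTheory.HeatConduction.pinnedChain ω₂ lam β γ).gibbsMeasure L T) (fun x => w x * ∑ i : Fin L, (Literature.MathematicalPhysics.KineticTheory.HeatConduction.pinnedChain ω₂ lam β γ).bondCurrent L i x)) ^ 2 ≤ 2 * MeasureTheory.integral ((Literature.MathematicalPhysics.KineticTheory.HeatConduction.pinnedChain ω₂ lam β γ).gibbsMeasure L T) (fun x => (∑ i : Fin L, (Literature.MathematicalPhysics.KineticTheory.HeatConduction.pinnedChain ω₂ lam β γ).bondCurrent L i x) * u x) * (s * MeasureTheory.integral ((Literature.MathematicalPhysics.KineticTheory.HeatConduction.pinnedChain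 ω₂ lam β γ).gibbsMeasure L T) (fun x => w x ^ 2) + ε / 2 * ∑ i : Fin L, MeasureTheory.integral ((Literature.MathematicalPhysics.KineticTheory.HeatConduction.pinnedChain ω₂ lam β γ).gibbsMeasure L T) (fun x => (w (Literature.MathematicalPhysics.KineticTheory.HeatConduction.momentumFlip i x) - w x) ^ 2) + γ * T * ∑ i : Fin L, Literature.MathematicalPhysics.KineticTheory.HeatConduction.OscillatorChain.bathWeight L i * MeasureTheory.integral ((Literature.MathematicalPhysics.KineticTheory.HeatConduction.pinnedChain ω₂ lam β γ).gibbsMeasure L T) (fun x => (Literature.MathematicalPhysics.KineticTheory.HeatConduction.partialP i w x) ^ 2) + 1 / ε * MeasureTheory.integral ((Literature.MathematicalPhysics.KineticTheory.HeatConduction.pinnedChain ω₂ lam β γ).gibbsMeasure L T) (fun x => ((Literature.MathematicalPhysics.KineticTheory.HeatConduction.pinnedChain ω₂ lam β γ).liouvillian L w x) ^ 2) + 1 / s * MeasureTheory.integral ((Literature.MathematicalPhysics.KineticTheory.HeatConduction.pinnedChain ω₂ lam β γ).gibbsMeasure L T) (fun x => ((∑ σ : Fin L → Bool, (Literature.MathematicalPhysics.KineticTheory.HeatConduction.pinnedChain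 ω₂ lam β γ).liouvillian L w (x.1, fun i => if σ i then -x.2 i else x.2 i)) / 2 ^ L) ^ 2)) :=
  fun _ _ _ _ _ _ hω hl hβ hγ hT hε _ _ hs _ _ hu hwC hw2 hXw2 hGw2 =>
    abelThomson_sq hω hl hβ hγ hT hε hs hu.1 hu.2.1 hu.2.2 hwC hw2 hXw2 hGw2

/-- Registered helper sub-goal `helper_bulkPositivityOfWitnessFamily` of crux stmt-AtomisticToContinuum-11977 (line
`abel-storage-decay`, stub B `stub_bulkAbelGKPositivity`): an asymptotically half-conserved witness family implies
the registered stub B verbatim (`bulkPositivity_of_witnessFamily`, restated). [folklore] -/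
theorem helper_bulkPositivityOfWitnessFamily : (∀ (ω₂ lam β γ T ε : ℝ), 0 < ω₂ → 0 < lam → 0 < β → 0 < γ → 0 < T → 0 < ε → ∃ c₁ c₂ : ℝ, 0 < c₁ ∧ ∀ δ : ℝ, 0 < δ → ∃ L₀ : ℕ, ∀ (L : ℕ), L₀ ≤ L → 2 ≤ L → ∃ w : Literature.MathematicalPhysics.KineticTheory.HeatConduction.PhaseSpace L → ℝ, ContDiff ℝ 2 w ∧ MeasureTheory.MemLp w 2 ((Literature.MathematicalPhysics.KineticTheory.HeatConduction.pinnedChain ω₂ lam β γ).gibbsMeasure L T) ∧ MeasureTheory.MemLp ((Literature.MathematicalPhysics.KineticTheory.HeatConduction.pinnedChain ω₂ lam β γ).liouvillian L w) 2 ((Literature.MathematicalPhysics.KineticTheory.HeatConduction.pinnedChain ω₂ lam β γ).gibbsMeasure L T) ∧ MeasureTheory.MemLp ((Literature.MathematicalPhysics.KineticTheory.HeatConduction.pinnedChain ω₂ lam β γ).generator L T T w) 2 ((Literature.MathematicalPhysics.KineticTheory.HeatConduction.pinnedChain ω₂ lam β γ).gibbsMeasure L T) ∧ c₁ * ((L :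 ℝ) - 1) ≤ MeasureTheory.integral ((Literature.MathematicalPhysics.KineticTheory.HeatConduction.pinnedChain ω₂ lam β γ).gibbsMeasure L T) (fun x => w x * ∑ i : Fin L, (Literature.MathematicalPhysics.KineticTheory.HeatConduction.pinnedChain ω₂ lam β γ).bondCurrent L i x) ∧ MeasureTheory.integral ((Literature.MathematicalPhysics.KineticTheory.HeatConduction.pinnedChain ω₂ lam β γ).gibbsMeasure L T) (fun x => w x ^ 2) ≤ c₂ * ((L : ℝ) - 1) ∧ ∑ i : Fin L, MeasureTheory.integral ((Literature.MathematicalPhysics.KineticTheory.HeatConduction.pinnedChain ω₂ lam β γ).gibbsMeasure L T) (fun x => (w (Literature.MathematicalPhysics.KineticTheory.HeatConduction.momentumFlip i x) - w x) ^ 2) ≤ c₂ * ((L : ℝ) - 1) ∧ ∑ i : Fin L, Literature.MathematicalPhysics.KineticTheory.HeatConduction.OscillatorChain.bathWeight L i * MeasureTheory.integral ((Literature.MathematicalPhysics.KineticTheory.HeatConduction.pinnedChain ω₂ lam β γ).gibbsMeasure L T) (fun x => (Literature.MathematicalPhysics.KineticTheory.HeatConduction.partialP i w x) ^ 2) ≤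 c₂ * ((L : ℝ) - 1) ∧ MeasureTheory.integral ((Literature.MathematicalPhysics.KineticTheory.HeatConduction.pinnedChain ω₂ lam β γ).gibbsMeasure L T) (fun x => ((Literature.MathematicalPhysics.KineticTheory.HeatConduction.pinnedChain ω₂ lam β γ).liouvillian L w x) ^ 2) ≤ c₂ * ((L : ℝ) - 1) ∧ MeasureTheory.integral ((Literature.MathematicalPhysics.KineticTheory.HeatConduction.pinnedChain ω₂ lam β γ).gibbsMeasure L T) (fun x => ((∑ σ : Fin L → Bool, (Literature.MathematicalPhysics.KineticTheory.HeatConduction.pinnedChain ω₂ lam β γ).liouvillian L w (x.1, fun i => if σ i then -x.2 i else x.2 i)) / 2 ^ L) ^ 2) ≤ δ * ((L : ℝ) - 1)) → (∀ (ω₂ lam β γ T ε : ℝ), 0 < ω₂ → 0 < lam → 0 < β → 0 < γ → 0 < T → 0 < ε → ∃ κ₀ : ℝ, 0 < κ₀ ∧ ∃ s₁ : ℝ, 0 < s₁ ∧ s₁ ≤ 1 ∧ ∀ s : ℝ, 0 < s → s ≤ s₁ → ∀ u : (L : ℕ) → Literature.MathematicalPhysics.KineticTheory.HeatConduction.PhaseSpace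 L → ℝ, (∀ L : ℕ, 2 ≤ L → ContDiff ℝ 2 (u L) ∧ MeasureTheory.MemLp (u L) 2 ((Literature.MathematicalPhysics.KineticTheory.HeatConduction.pinnedChain ω₂ lam β γ).gibbsMeasure L T) ∧ ∀ x, (Literature.MathematicalPhysics.KineticTheory.HeatConduction.pinnedChain ω₂ lam β γ).flipGenerator L T T ε (u L) x = s * u L x - ∑ i : Fin L, (Literature.MathematicalPhysics.KineticTheory.HeatConduction.pinnedChain ω₂ lam β γ).bondCurrent L i x) → ∀ K : ℝ, Filter.Tendsto (fun L : ℕ => (MeasureTheory.integral ((Literature.MathematicalPhysics.KineticTheory.HeatConduction.pinnedChain ω₂ lam β γ).gibbsMeasure L T) (fun x => (∑ i : Fin L, (Literature.MathematicalPhysics.KineticTheory.HeatConduction.pinnedChain ω₂ lam β γ).bondCurrent L i x) * u L x)) / ((L : ℝ) - 1)) Filter.atTop (nhds K) → κ₀ * T ^ 2 ≤ K) :=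
  fun hW => bulkPositivity_of_witnessFamily hW

end Summit.AtomisticToContinuum.FouriersLaw.Theorems.NoisyFourier.AbelThomson

end
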